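import Mathlib.Analysis.SpecialFunctions.Pow.Real
import Mathlib.Combinatorics.Additive.AP.Three.Behrend
import Literature.Combinatorics.Additive.TripleProductProperty
import HarnessLib

/-!
# Pratt 2024, proof of Thm. 4.7: from SDPP pairs to an STPP family in `H³` (CKSU construction)

K. Pratt, *On generalized corners and matrix multiplication*, arXiv:2309.03878 [Pratt2024],
proof of Thm. 4.7 (p. 10): "We begin by recalling how to turn an SDPP construction into an STPP
construction [CKSU 2005]. Let `S ⊂ Δₙ` be corner-free and of size `n^{2-o(1)}`. For all
`v = (v₁,v₂,v₃) ∈ S`, define the following subsets of `G³`: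
`A_v = A_{v₁} × {1} × B_{v₃}`, `B_v = B_{v₁} × A_{v₂} × {1}`, `C_v = {1} × B_{v₂} × A_{v₃}`.
It can be verified that the sets `(A_v, B_v, C_v)_{v ∈ S}` satisfy the STPP."  (Def. 2.4 = CKSU
2005 §4: the simultaneous double product property.)  Everything here is PROVED; this is the third
step of the discharge of the named fact `pratt2024_thm47` (`PrattTrapezoidVal.lean`).

* `addSimultaneousTPP_of_sdpp` — the verification "it can be verified that …", for pairs
  `(Aᵢ, Bᵢ)_{i<n}` with the SDPP written exactly as inlined in `pratt2024_thm47` (each pair has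
  the double product property; `(aᵢ - a'ⱼ) + (bⱼ - b'ₖ) = 0 ⟹ i = k`), and ANY three index maps
  `i₁ i₂ i₃ : ι₀ → Fin n` with the corner-freeness property the verification actually uses:
  `i₁ x = i₁ z → i₂ y = i₂ x → i₃ z = i₃ y → x = y = z` (for `S ⊆ Δₙ` and `i_t(v) = v_t` this
  says that `S` has no configuration `(x, y, z), (x - d, y, z + d), (x, y - d, z + d)`, `d ≠ 0`,
  i.e. no equilateral triangle with sides parallel to those of `Δₙ`, of either orientation);
  `card_mul_card_mul_card_sdpp` — `|A_v||B_v||C_v| = ∏_t |A_{v_t}||B_{v_t}|`.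
* `exists_cornerFree_indexMaps` — a corner-free index configuration of size `m · |R|` inside
  `Fin n'` from a 3AP-free `R ⊆ {0,…,m-1}`, `4m ≤ n'`: the points
  `v = (n'-1-2y-r, y, y+r)`, `y < m`, `r ∈ R` (a corner as above has `v₃ - v₂ ∈ {r, r', r''}`
  in arithmetic progression) — the standard Behrend-type corner-free set, which the source
  uses without comment ("Let `S ⊂ Δₙ` be corner-free and of size `n^{2-o(1)}`");
* `exists_threeAPFree_card_ge_rpow`, `exists_cornerFree_indexMaps_card_ge` — with Mathlib's
  `Behrend.roth_lower_bound`: for `0 < η ≤ 1` and all large `n'`, such a configuration with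
  `n'^{2-η} ≤ 64 |ι₀|`.

## References

* [Pratt2024] K. Pratt, arXiv:2309.03878, Def. 2.4, Conj. 2.5 (p. 5), proof of Thm. 4.7 (p. 10).
* [CohnKleinbergSzegedyUmans2005] H. Cohn, R. Kleinberg, B. Szegedy, C. Umans, FOCS 2005, §4–§6
  (SDPP, and the passage from two families to STPP families via `Δₙ`).
* F. A. Behrend, PNAS 32 (1946) — via Mathlib `Behrend.roth_lower_bound`.
-/

namespace Literature.Computability.AlgebraicComplexity

open Finset Literature.Combinatorics.Additive

/-! ### The CKSU construction -/

section CKSU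

variable {H : Type*} [AddCommGroup H] {n : ℕ} {A B : Fin n → Finset H}

/-- Sizes in the CKSU construction: `|A_v| |B_v| |C_v| = ∏_{t=1}^3 |A_{v_t}| |B_{v_t}|`.
[cite: Pratt2024, Thm. 4.7 (proof)] -/
theorem card_mul_card_mul_card_sdpp {ι₀ : Type*} (i₁ i₂ i₃ : ι₀ → Fin n) (x : ι₀) :
    #(A (i₁ x) ×ˢ (({0} : Finset H) ×ˢ B (i₃ x))) * #(B (i₁ x) ×ˢ (A (i₂ x) ×ˢ ({0} : Finset H))) *
      #(({0} : Finset H) ×ˢ (B (i₂ x) ×ˢ A (i₃ x))) =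
      (#(A (i₁ x)) * #(B (i₁ x))) * (#(A (i₂ x)) * #(B (i₂ x))) * (#(A (i₃ x)) * #(B (i₃ x))) := by
  simp only [card_product, card_singleton, one_mul, mul_one]
  ring

/-- **The SDPP-to-STPP construction of CKSU 2005, as recalled in the proof of Pratt's Thm. 4.7**:
if the pairs `(Aᵢ, Bᵢ)_{i<n}` satisfy the simultaneous double product property (Pratt Def. 2.4,
additively: `(a - a') + (b - b') = 0 ⟹ a = a', b = b'` inside each pair, and
`(aᵢ - a'ⱼ) + (bⱼ - b'ₖ) = 0 ⟹ i = k` across pairs) and the index maps `i₁, i₂, i₃` are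
corner-free in the sense `i₁ x = i₁ z → i₂ y = i₂ x → i₃ z = i₃ y → x = y = z`, then the triples
`A_x = A_{i₁x} × {0} × B_{i₃x}`, `B_x = B_{i₁x} × A_{i₂x} × {0}`, `C_x = {0} × B_{i₂x} × A_{i₃x}`
form an STPP family in `H³` (CKSU Def. 5.1, tree `AddSimultaneousTPP`).
[cite: Pratt2024, Thm. 4.7 (proof)] [cite: CohnKleinbergSzegedyUmans2005, §6] -/
theorem addSimultaneousTPP_of_sdpp
    (hD : ∀ i : Fin n, ∀ a ∈ A i, ∀ a' ∈ A i, ∀ b ∈ B i, ∀ b' ∈ B i,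
      (a - a') + (b - b') = 0 → a = a' ∧ b = b')
    (hSD : ∀ i j k : Fin n, ∀ a ∈ A i, ∀ a' ∈ A j, ∀ b ∈ B j, ∀ b' ∈ B k,
      (a - a') + (b - b') = 0 → i = k)
    {ι₀ : Type*} (i₁ i₂ i₃ : ι₀ → Fin n)
    (hcf : ∀ x y z : ι₀, i₁ x = i₁ z → i₂ y = i₂ x → i₃ z = i₃ y → x = y ∧ y = z) :
    AddSimultaneousTPP (fun x => A (i₁ x) ×ˢ (({0} : Finset H) ×ˢ B (i₃ x)))
      (fun x => B (i₁ x) ×ˢ (A (i₂ x) ×ˢ ({0} : Finset H)))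
      (fun x => ({0} : Finset H) ×ˢ (B (i₂ x) ×ˢ A (i₃ x))) := by
  refine ⟨fun x s hs s' hs' t ht t' ht' u hu u' hu' he => ?_,
    fun i j k a ha a' ha' b hb b' hb' c hc c' hc' he => ?_⟩
  · simp only [mem_product, mem_singleton] at hs hs' ht ht' hu hu'
    obtain ⟨hs1, hs2, hs3⟩ := hs
    obtain ⟨hs'1, hs'2, hs'3⟩ := hs'
    obtain ⟨ht1, ht2, ht3⟩ := ht
    obtain ⟨ht'1, ht'2, ht'3⟩ := ht'
    obtain ⟨hu1, hu2, hu3⟩ := hu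
    obtain ⟨hu'1, hu'2, hu'3⟩ := hu'
    simp only [← sub_eq_add_neg] at he
    have h1 : s.1 - s'.1 + (t.1 - t'.1) + (u.1 - u'.1) = 0 := congrArg Prod.fst he
    have h2 : s.2.1 - s'.2.1 + (t.2.1 - t'.2.1) + (u.2.1 - u'.2.1) = 0 :=
      congrArg (fun p : H × H × H => p.2.1) he
    have h3 : s.2.2 - s'.2.2 + (t.2.2 - t'.2.2) + (u.2.2 - u'.2.2) = 0 :=
      congrArg (fun p : H × H × H => p.2.2) he
    rw [hu1, hu'1, sub_zero, add_zero] at h1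
    rw [hs2, hs'2, sub_zero, zero_add] at h2
    rw [ht3, ht'3, sub_zero, add_zero] at h3
    obtain ⟨e1, e2⟩ := hD _ _ hs1 _ hs'1 _ ht1 _ ht'1 h1
    obtain ⟨e3, e4⟩ := hD _ _ ht2 _ ht'2 _ hu2 _ hu'2 h2
    obtain ⟨e5, e6⟩ := hD _ _ hu3 _ hu'3 _ hs3 _ hs'3 (by rw [add_comm]; exact h3)
    exact ⟨Prod.ext e1 (Prod.ext (hs2.trans hs'2.symm) e6),
      Prod.ext e2 (Prod.ext e3 (ht3.trans ht'3.symm)), Prod.ext (hu1.trans hu'1.symm) (Prod.ext e4 e5)⟩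
  · simp only [mem_product, mem_singleton] at ha ha' hb hb' hc hc'
    obtain ⟨ha1, ha2, ha3⟩ := ha
    obtain ⟨ha'1, ha'2, ha'3⟩ := ha'
    obtain ⟨hb1, hb2, hb3⟩ := hb
    obtain ⟨hb'1, hb'2, hb'3⟩ := hb'
    obtain ⟨hc1, hc2, hc3⟩ := hc
    obtain ⟨hc'1, hc'2, hc'3⟩ := hc'
    simp only [← sub_eq_add_neg] at he
    have h1 : a.1 - a'.1 + b.1 - b'.1 + c.1 - c'.1 = 0 := congrArg Prod.fst he
    have h2 : a.2.1 - a'.2.1 + b.2.1 - b'.2.1 + c.2.1 - c'.2.1 = 0 :=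
      congrArg (fun p : H × H × H => p.2.1) he
    have h3 : a.2.2 - a'.2.2 + b.2.2 - b'.2.2 + c.2.2 - c'.2.2 = 0 :=
      congrArg (fun p : H × H × H => p.2.2) he
    rw [hc1, hc'1, add_zero, sub_zero] at h1
    rw [ha2, ha'2, sub_zero, zero_add] at h2
    rw [hb3, hb'3, add_zero, sub_zero] at h3
    have k1 := hSD _ _ _ _ ha1 _ ha'1 _ hb1 _ hb'1 (by rw [← add_sub_assoc]; exact h1)
    have k2 := hSD _ _ _ _ hb2 _ hb'2 _ hc2 _ hc'2 (by rw [← add_sub_assoc]; exact h2)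
    have k3 := hSD _ _ _ _ hc3 _ hc'3 _ ha3 _ ha'3 (by rw [add_comm, ← add_sub_assoc]; exact h3)
    exact hcf i j k k1 k2 k3

end CKSU

/-! ### A corner-free index configuration from a 3AP-free set (Behrend) -/

section CornerFree

/-- **A corner-free subset of `Δ_{n'}` from a 3AP-free set**: for `R ⊆ {0,…,m-1}` without
three-term arithmetic progressions and `4m ≤ n'`, the `m · |R|` points
`(n'-1-2y-r, y, y+r)`, `y < m`, `r ∈ R`, of `Δ_{n'} = {v ∈ ℤ_{≥0}³ : v₁+v₂+v₃ = n'-1}` contain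
no configuration `(x, y, z), (x-d, y, z+d), (x, y-d, z+d)` with `d ≠ 0` (the differences
`v₃ - v₂` of its three points would be `r, r', r''` with `r + r'' = 2r'`).  Stated for the three
coordinate maps into `Fin n'`, in the form consumed by `addSimultaneousTPP_of_sdpp`.  This is the
standard construction behind "Let `S ⊂ Δₙ` be corner-free and of size `n^{2-o(1)}`" in the proof
of Pratt's Thm. 4.7. [cite: Pratt2024, Thm. 4.7 (proof)] -/
theorem exists_cornerFree_indexMaps (n' m : ℕ) (R : Finset ℕ) (hR : R ⊆ range m)
    (hR3 : ThreeAPFree (R : Set ℕ)) (hm : 4 * m ≤ n') :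
    ∃ (ι₀ : Type) (_ : Fintype ι₀) (_ : DecidableEq ι₀) (j₁ j₂ j₃ : ι₀ → Fin n'),
      Fintype.card ι₀ = m * #R ∧
      ∀ x y z : ι₀, j₁ x = j₁ z → j₂ y = j₂ x → j₃ z = j₃ y → x = y ∧ y = z := by
  classical
  have hb : ∀ x : ↥(range m ×ˢ R), x.1.1 < m ∧ x.1.2 < m ∧ x.1.2 ∈ R := fun x => by
    have hx := Finset.mem_product.1 x.2
    exact ⟨mem_range.1 hx.1, mem_range.1 (hR hx.2), hx.2⟩
  refine ⟨↥(range m ×ˢ R), inferInstance, inferInstance,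
    fun x => ⟨n' - 1 - 2 * x.1.1 - x.1.2, by have := hb x; omega⟩,
    fun x => ⟨x.1.1, by have := hb x; omega⟩,
    fun x => ⟨x.1.1 + x.1.2, by have := hb x; omega⟩, ?_, ?_⟩
  · rw [Fintype.card_coe, card_product, card_range]
  · rintro ⟨⟨y, r⟩, hx⟩ ⟨⟨y', r'⟩, hx'⟩ ⟨⟨y'', r''⟩, hx''⟩ h1 h2 h3
    simp only [Fin.mk.injEq] at h1 h2 h3
    obtain ⟨by1, br1, hr⟩ := hb ⟨(y, r), hx⟩
    obtain ⟨by2, br2, hr'⟩ := hb ⟨(y', r'), hx'⟩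
    obtain ⟨by3, br3, hr''⟩ := hb ⟨(y'', r''), hx''⟩
    simp only at by1 br1 hr by2 br2 hr' by3 br3 hr''
    have hAP : r + r'' = r' + r' := by omega
    have e1 : r = r' := hR3 (mem_coe.2 hr) (mem_coe.2 hr') (mem_coe.2 hr'') hAP
    subst e1
    have e2 : r'' = r := by omega
    subst e2
    have e3 : y' = y := by omega
    have e4 : y'' = y := by omega
    subst e3 e4
    exact ⟨rfl, rfl⟩

/-- **Behrend's lower bound in exponent form** (from Mathlib's `Behrend.roth_lower_bound`,
`N e^{-4√(log N)} ≤ r₃(N)`): for every `η > 0` and all large `m`, `{0,…,m-1}` contains a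
3AP-free set of size `≥ m^{1-η}` (as soon as `log m ≥ 16/η²`). [folklore] -/
theorem exists_threeAPFree_card_ge_rpow (η : ℝ) (hη : 0 < η) :
    ∃ m₀ : ℕ, ∀ m ≥ m₀, (m : ℝ) ^ (1 - η) ≤ rothNumberNat m := by
  refine ⟨⌈Real.exp (16 / η ^ 2)⌉₊ + 2, fun m hm => ?_⟩
  have hm1 : (1 : ℝ) < m := by exact_mod_cast (show 1 < m by omega)
  have hmpos : (0 : ℝ) < m := by linarith
  have hlogm : 16 / η ^ 2 ≤ Real.log m := by
    have h1 : Real.exp (16 / η ^ 2) ≤ m := by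
      have h2 := Nat.le_ceil (Real.exp (16 / η ^ 2))
      have h3 : (⌈Real.exp (16 / η ^ 2)⌉₊ : ℝ) ≤ m := by
        exact_mod_cast (show ⌈Real.exp (16 / η ^ 2)⌉₊ ≤ m by omega)
      linarith
    have h4 := Real.log_le_log (Real.exp_pos _) h1
    rwa [Real.log_exp] at h4
  refine le_trans ?_ Behrend.roth_lower_bound
  rw [Real.rpow_sub hmpos, Real.rpow_one, div_eq_mul_inv, ← Real.rpow_neg hmpos.le]
  refine mul_le_mul_of_nonneg_left ?_ hmpos.le
  rw [Real.rpow_def_of_pos hmpos, Real.exp_le_exp]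
  have hL : 0 ≤ Real.log m := Real.log_nonneg hm1.le
  have hsqrt : 4 / η ≤ Real.sqrt (Real.log m) := by
    rw [Real.le_sqrt (by positivity) hL]
    calc (4 / η) ^ 2 = 16 / η ^ 2 := by ring
      _ ≤ Real.log m := hlogm
  have h4 : 4 ≤ η * Real.sqrt (Real.log m) := by
    have h5 := mul_le_mul_of_nonneg_left hsqrt hη.le
    rwa [mul_div_cancel₀ _ hη.ne'] at h5
  set s := Real.sqrt (Real.log m) with hs
  have hs0 : 0 ≤ s := Real.sqrt_nonneg _
  have hL' : Real.log m = s * s := (Real.mul_self_sqrt hL).symm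
  rw [hL']
  nlinarith [h4, hs0]

/-- **A large corner-free index configuration** (Behrend + `exists_cornerFree_indexMaps`): for
`0 < η ≤ 1` and all large `n'` there is a corner-free configuration `j₁, j₂, j₃ : ι₀ → Fin n'`
(in the sense consumed by `addSimultaneousTPP_of_sdpp`) with `n'^{2-η} ≤ 64 |ι₀|` — the
"corner-free `S ⊂ Δₙ` of size `n^{2-o(1)}`" of the proof of Pratt's Thm. 4.7 (taking
`m = ⌊n'/4⌋` and a 3AP-free `R ⊆ {0,…,m-1}` of size `≥ m^{1-η}`).
[cite: Pratt2024, Thm. 4.7 (proof)] -/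
theorem exists_cornerFree_indexMaps_card_ge (η : ℝ) (hη : 0 < η) (hη1 : η ≤ 1) :
    ∃ n₁ : ℕ, ∀ n' ≥ n₁, ∃ (ι₀ : Type) (_ : Fintype ι₀) (_ : DecidableEq ι₀)
      (j₁ j₂ j₃ : ι₀ → Fin n'), (n' : ℝ) ^ (2 - η) ≤ 64 * Fintype.card ι₀ ∧
      ∀ x y z : ι₀, j₁ x = j₁ z → j₂ y = j₂ x → j₃ z = j₃ y → x = y ∧ y = z := by
  obtain ⟨m₀, hm₀⟩ := exists_threeAPFree_card_ge_rpow η hη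
  refine ⟨4 * m₀ + 8, fun n' hn' => ?_⟩
  set m := n' / 4 with hm
  have h4m : 4 * m ≤ n' := by omega
  have hmm₀ : m₀ ≤ m := by omega
  have h8m : n' ≤ 8 * m := by omega
  obtain ⟨R, hRsub, hRcard, hR3⟩ := rothNumberNat_spec m
  obtain ⟨ι₀, _, _, j₁, j₂, j₃, hcard, hcf⟩ := exists_cornerFree_indexMaps n' m R hRsub hR3 h4m
  refine ⟨ι₀, ‹_›, ‹_›, j₁, j₂, j₃, ?_, hcf⟩
  have hmpos : (0 : ℝ) < m := by exact_mod_cast (show 0 < m by omega)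
  have hn'8 : (n' : ℝ) / 8 ≤ m := by
    rw [div_le_iff₀ (by norm_num : (0 : ℝ) < 8)]
    exact_mod_cast (show n' ≤ m * 8 by omega)
  have hR : (m : ℝ) ^ (1 - η) ≤ #R := by rw [hRcard]; exact hm₀ m hmm₀
  have h2η : 0 ≤ 2 - η := by linarith
  have h64 : (8 : ℝ) ^ (2 - η) ≤ 64 := by
    calc (8 : ℝ) ^ (2 - η) ≤ (8 : ℝ) ^ (2 : ℝ) :=
          Real.rpow_le_rpow_of_exponent_le (by norm_num) (by linarith)
      _ = 64 := by rw [Real.rpow_two]; norm_num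
  calc (n' : ℝ) ^ (2 - η) = (8 * ((n' : ℝ) / 8)) ^ (2 - η) := by
        rw [mul_div_cancel₀ _ (by norm_num : (8 : ℝ) ≠ 0)]
    _ = (8 : ℝ) ^ (2 - η) * ((n' : ℝ) / 8) ^ (2 - η) :=
        Real.mul_rpow (by norm_num) (by positivity)
    _ ≤ 64 * (m : ℝ) ^ (2 - η) :=
        mul_le_mul h64 (Real.rpow_le_rpow (by positivity) hn'8 h2η)
          (Real.rpow_nonneg (by positivity) _) (by norm_num)
    _ = 64 * ((m : ℝ) * (m : ℝ) ^ (1 - η)) := by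
        rw [show (2 - η : ℝ) = 1 + (1 - η) by ring, Real.rpow_add hmpos, Real.rpow_one]
    _ ≤ 64 * ((m : ℝ) * #R) := by gcongr
    _ = 64 * Fintype.card ι₀ := by rw [hcard]; push_cast; ring

end CornerFree

end Literature.Computability.AlgebraicComplexity
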